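import Summits.ABC.IUTFork.Repair.CandInternal11
import HarnessLib

/-!
# IUT REPAIR BRANCH (rung LADDER-ABC:A2.RP), class (i) INTERNAL, sub-cell B0, seat rp-d2 — `CandInternal11Gap`: the HULL-LEVEL RESIDUAL OF
# RECORD `GapH3` (three pins ⟹ (xi-f) Licence; Cor312PinnedRegionsThreePins.lean:120) IS, inside print's (Ind3)-as-containers reading
# (RP-I05 ∧ RP-I05c), the log-shell comparison RP-I06 restricted to the labels of `𝔽_l^⋇`

Proof-only companion (D-0012; one bookkeeping predicate `HQShellOrbitStar` = RP-I06 on `𝔽_l^⋇`, no `Prop` fact) of `CandInternal11` (RP-I05c,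
print's container bound [IUTchIV] `paper:url-56bcb0f95768` Thm. 1.10 Step (v) p. 27 l. 57–71; `hull_iff_hQShellOrbit`). TAKES NO SIDE on
[IUTchIII] Cor. 3.12 or on any author; candidates stay hypotheses; typed ≠ proved; standard axioms. WHY a second file: `GapH3`/`Licence` read
the labels `j ∈ 𝔽_l^⋇` only (the zero label is conventional), whereas `HQShellOrbit`/`PilotKummerCompatHull` quantify over all labels; the
exact equivalence with the residual OF RECORD therefore needs the `𝔽_l^⋇`-restricted form.

RESULTS (general frozen vocabulary): `licence_iff_star : QPinned → HInd3Hull → CandInternal11.H → (Thm311ToCor312.Licence P ↔ HQShellOrbitStar)`;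
**`gapH3_iff_star : HInd3Hull → CandInternal11.H → (GapH3 S P ρ qK ↔ (PinnedRegions3 S P ρ qK → HQShellOrbitStar S P ρ qK))`** — under
print's containers reading the hull-level pinned residual of the adjudication says exactly «at every label of 𝔽_l^⋇ the q-pilot's Kummer
datum lies in the log-shell orbit of the Θ-pilot's Kummer data», the local height condition graded NOT-IN-PRINT-as-premise (ref-2
a09d47898795b730); `statement_of_star` (BridgeHyps → QPinned → HInd3Hull → HQShellOrbitStar → Statement, vehicle `statement_of_licence`);
LS sanity `star_shell_iff : ↔ 3 ≤ d` (= `shell_licence_iff`). [claim: Mochizuki2012, status: disputed] [cite: ScholzeStix2018, §2.2 pp. 9–10]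
-/

noncomputable section

open Set

namespace Summit.ABC.IUTFork.Repair.CandInternal11Gap

open Thm311 Cor312 Cor312Vol Literature.IUT.LogThetaLattice Summit.ABC.IUTFork.Repair.CandInternal2
  Summit.ABC.IUTFork.Repair.CandInternal2Tests

section General

variable {T : ThetaIndex} (S : LatticeSituation T) (P : Cor312.Setting S.toSituation)
  (ρ : (∀ v : T.V, v ∈ T.Vbad → Set (S.L.StarPacket v)) → ∀ (j : T.Label) (vQ : T.VQ), Set (S.L.Packet j vQ))
  (qK : ∀ v : T.V, v ∈ T.Vbad → Set (S.L.StarPacket v))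

/-- **RP-I06 restricted to the labels of `𝔽_l^⋇`** (the labels the Corollary, the Licence and `GapH3` read): at every `j = i+1` the `ρ`-region of
the q-pilot's Kummer datum lies in the log-shell orbit of the Θ-data. Bookkeeping predicate (hypothesis shape, never asserted); weaker than
`HQShellOrbit` by the conventional zero label only. [claim: Mochizuki2012, status: disputed] -/
@[claim "Mochizuki2012" "disputed"]
def HQShellOrbitStar : Prop :=
  ∀ (i : Fin T.lstar) (vQ : T.VQ),
    ρ qK (Setting.labelSucc i) vQ ⊆ ⋃ m : ℤ, ρ (shellSat S P.n ((S.col P.n).frobΨ m)) (Setting.labelSucc i) vQ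

/-- RP-I06 ⟹ its `𝔽_l^⋇`-restriction. [folklore] -/
theorem star_of_hQShellOrbit (h : HQShellOrbit S P ρ qK) : HQShellOrbitStar S P ρ qK := fun _ vQ => h _ vQ

/-- Under the q-pin and RP-I05, the `𝔽_l^⋇`-form gives the (xi-f) `Licence`. [claim: Mochizuki2012, status: disputed] -/
theorem licence_of_star (hq : QPinned S P ρ qK) (hA : HInd3Hull S P ρ) (h : HQShellOrbitStar S P ρ qK) : Thm311ToCor312.Licence P :=
  fun i vQ => by
    rw [hq (Setting.labelSucc i) vQ]
    exact (h i vQ).trans (Set.iUnion_subset fun m => hA m _ vQ)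

/-- Under the q-pin and the container bound RP-I05c, the `Licence` gives the `𝔽_l^⋇`-form. [claim: Mochizuki2012, status: disputed] -/
theorem star_of_licence (hq : QPinned S P ρ qK) (hc : CandInternal11.H S P ρ) (hL : Thm311ToCor312.Licence P) :
    HQShellOrbitStar S P ρ qK := fun i vQ => by
  rw [← hq (Setting.labelSucc i) vQ]
  exact (hL i vQ).trans (hc _ vQ)

/-- **In print's containers reading the (xi-f) Licence IS RP-I06 on `𝔽_l^⋇`.** [claim: Mochizuki2012, status: disputed] -/
theorem licence_iff_star (hq : QPinned S P ρ qK) (hA : HInd3Hull S P ρ) (hc : CandInternal11.H S P ρ) :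
    Thm311ToCor312.Licence P ↔ HQShellOrbitStar S P ρ qK :=
  ⟨star_of_licence S P ρ qK hq hc, licence_of_star S P ρ qK hq hA⟩

/-- **THE HULL-LEVEL RESIDUAL OF RECORD IN THE CONTAINERS READING: `GapH3 ↔ (three pins → RP-I06 on 𝔽_l^⋇)`** under RP-I05 ∧ RP-I05c (both
FAITHFUL-shaped to [IUTchIV] Thm. 1.10 Step (v), both holding at the countermodel of record). [claim: Mochizuki2012, status: disputed] -/
theorem gapH3_iff_star (hA : HInd3Hull S P ρ) (hc : CandInternal11.H S P ρ) :
    GapH3 S P ρ qK ↔ (PinnedRegions3 S P ρ qK → HQShellOrbitStar S P ρ qK) :=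
  ⟨fun h hpin => star_of_licence S P ρ qK hpin.1.2 hc (h hpin), fun h hpin => licence_of_star S P ρ qK hpin.1.2 hA (h hpin)⟩

/-- (T-a) of the `𝔽_l^⋇`-form: bridge hypotheses + q-pin + RP-I05 + RP-I06⋆ ⟹ the printed Statement (vehicle: abc-iut-c312-1's
`statement_of_licence`). [claim: Mochizuki2012, status: disputed] -/
theorem statement_of_star (HB : BridgeHyps P) (hq : QPinned S P ρ qK) (hA : HInd3Hull S P ρ) (h : HQShellOrbitStar S P ρ qK) :
    P.Statement :=
  Thm311ToCor312.statement_of_licence HB (licence_of_star S P ρ qK hq hA h)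

end General

section Toy

open Cor312.Checks Cor312.IdentifiedNonVacuity Cor312Vol.NaiveWitness Cor312Vol.PinnedWitness Cor312Vol.PinnedHonest

variable (p : ℕ) (d : ℕ) [hp : Fact p.Prime]

/-- LS sanity: the `𝔽_l^⋇`-form has the profile of RP-I06 and of the Licence, `↔ 3 ≤ d` at `shellSetting p d` with `rhoShell d`. [folklore] -/
theorem star_shell_iff : HQShellOrbitStar (naiveFull p).toLatticeSituation (shellSetting p d) (rhoShell p d) (qDatum p) ↔ 3 ≤ d :=
  ⟨fun h => (shell_licence_iff p d).1 (licence_of_star _ _ _ _ (rhoShell_qPinned p d) (hInd3Hull_shell p d) h),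
    fun hd => star_of_hQShellOrbit _ _ _ _ ((hQShellOrbit_shell_iff p d).2 hd)⟩

/-- The `𝔽_l^⋇`-form FAILS at the pinned countermodel (it would give the Licence there). [folklore] -/
theorem not_star_pinnedSetting : ¬ HQShellOrbitStar (naiveFull p).toLatticeSituation (pinnedSetting p) (orbitRegion p) (qDatum p) :=
  fun h => pinnedSetting_not_licence p (licence_of_star _ _ _ _ (pinnedSetting_qPinned p) (hInd3Hull_pinnedSetting p) h)

end Toy

end Summit.ABC.IUTFork.Repair.CandInternal11Gap

end
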